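import Literature.Analysis.FluidPDE.CompressibleEulerImplosionOriginSeriesTM
import HarnessLib

/-!
# Buckmaster–Cao-Labora–Gómez-Serrano at `γ = 5/3`: checking literal Taylor models of the centre series

Sequel of `CompressibleEulerImplosionOriginSeriesTM` (the Taylor-model mirror `wModels` / `nextTM` of the
coefficient recursion (2.12) of the profile series at `P₀`, with soundness `tmem_wModels`). Evaluating
`wModels … N` in ONE kernel computation costs `O(N³)`; this file provides the STEPWISE certificate format
used by the window files: the models `L = [L₀, …, L_N]` are written as literal data, and the kernel checks,
for each `k < N` separately, the inclusion `nextTM … L k ⊆ L_{k+1}` (`stepOK`, interval containment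
`ipIncl`), plus `baseOK` (`L₀ ∋ 1`). Soundness `tmem_of_stepsOK`: then `L_i` encloses `ρ ↦ wᵢ(r(ρ))` for all
`i ≤ N` (strong induction with `tmem_nextTM`). Finally `bndCheck`/`bnd_of_bndCheck` read rational bounds of
all coefficients off the literal models at once (via `bounds_of_tmem`). Problem-independent bookkeeping; no
facts, no axioms.

[cite: BuckmasterCaolaboraGomezserrano2025, Prop. 2.5, eq. (2.12), App. B]
-/

namespace Literature.Analysis.FluidPDE

namespace BuckmasterCaolaboraGomezserrano2025

namespace OriginSeries

open Finset
open Literature.Analysis.ValidatedNumerics Literature.Analysis.ValidatedNumerics.PolyMP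
open Literature.Analysis.ValidatedNumerics.NumericsMP

/-! ### Interval containment -/

/-- `I ⊆ J` for scaled intervals. [folklore] -/
def miIncl (I J : MI) : Bool := decide (J.lo ≤ I.lo) && decide (I.hi ≤ J.hi)

/-- [folklore] -/
theorem mem_of_miIncl {S : ℕ} {x : ℝ} {I J : MI} (h : miIncl I J = true) (hx : MI.mem S x I) :
    MI.mem S x J := by
  simp only [miIncl, Bool.and_eq_true, decide_eq_true_eq] at h
  obtain ⟨h1, h2⟩ := h
  have h1' : ((J.lo : ℤ) : ℝ) ≤ (I.lo : ℝ) := by exact_mod_cast h1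
  have h2' : ((I.hi : ℤ) : ℝ) ≤ (J.hi : ℝ) := by exact_mod_cast h2
  exact ⟨h1'.trans hx.1, hx.2.trans h2'⟩

/-- Coefficientwise containment of interval polynomials of the same length. [folklore] -/
def ipIncl : IPoly → IPoly → Bool
  | [], [] => true
  | I :: P, J :: Q => miIncl I J && ipIncl P Q
  | _, _ => false

/-- [folklore] -/
theorem pmem_of_ipIncl {S : ℕ} : ∀ {as : List ℝ} {P Q : IPoly}, ipIncl P Q = true → PMem S as P → PMem S as Q
  | _, [], [], _, h => by
      cases h; exact pmem_nil S
  | _, I :: P, J :: Q, hi, h => by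
      cases h with
      | cons ha hP =>
        simp only [ipIncl, Bool.and_eq_true] at hi
        exact pmem_cons (mem_of_miIncl hi.1 ha) (pmem_of_ipIncl hi.2 hP)
  | _, [], _ :: _, hi, _ => by simp [ipIncl] at hi
  | _, _ :: _, [], hi, _ => by simp [ipIncl] at hi

/-- A Taylor model may be replaced by any coefficientwise larger one. [folklore] -/
theorem tmem_of_ipIncl {S : ℕ} {h : ℚ} {f : ℝ → ℝ} {P Q : IPoly} (hi : ipIncl P Q = true)
    (hf : TMem S h f P) : TMem S h f Q := fun ρ hρ => by
  obtain ⟨as, has, e⟩ := hf ρ hρ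
  exact ⟨as, pmem_of_ipIncl hi has, e⟩

/-! ### The stepwise certificate -/

/-- The base check: `1 ∈ L₀` (as the constant model). [folklore] -/
def baseOK (S : ℕ) (L : List IPoly) : Bool := ipIncl (tconst (MI.ofInt S 1)) (ent S L 0)

/-- The step check at `k`: the forced model of `w_{k+1}` computed from `L₀, …, L_k` is contained in
`L_{k+1}`. [cite: BuckmasterCaolaboraGomezserrano2025, eq. (2.12)] -/
def stepOK (S : ℕ) (h : ℚ) (D : ℕ) (R1 : IPoly) (L : List IPoly) (k : ℕ) : Bool :=
  ipIncl (nextTM S h D R1 L k) (ent S L (k + 1))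

variable {S : ℕ} {h : ℚ} {D : ℕ} {R1 : IPoly} {rF : ℝ → ℝ}

/-- **Soundness of the stepwise certificate.** [cite: BuckmasterCaolaboraGomezserrano2025, Prop. 2.5, eq. (2.12)] -/
theorem tmem_of_stepsOK (hS : 0 < S) (h0 : 0 ≤ h) (hR1 : TMem S h (fun ρ => rF ρ - 1) R1)
    {L : List IPoly} {N : ℕ} (hbase : baseOK S L = true)
    (hsteps : ∀ k, k < N → stepOK S h D R1 L k = true) :
    ∀ i, i ≤ N → TMem S h (fun ρ => w (rF ρ) 1 i) (ent S L i) := by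
  intro i
  induction i using Nat.strong_induction_on with
  | _ i ih =>
    intro hi
    cases i with
    | zero =>
      have h1 : TMem S h (fun _ => (1 : ℝ)) (tconst (MI.ofInt S 1)) := by
        have := tmem_const (S := S) (h := h) (MI.mem_ofInt S 1)
        simpa using this
      have e : (fun ρ => w (rF ρ) 1 0) = fun _ => (1 : ℝ) := by funext ρ; simp
      rw [e]
      exact tmem_of_ipIncl hbase h1
    | succ k =>
      have hk : k < N := Nat.lt_of_succ_le hi
      have hL : ∀ j, j ≤ k → TMem S h (fun ρ => w (rF ρ) 1 j) (ent S L j) :=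
        fun j hj => ih j (Nat.lt_succ_of_le hj) (hj.trans (Nat.le_of_lt hk))
      exact tmem_of_ipIncl (hsteps k hk) (tmem_nextTM (D := D) hS h0 hR1 hL)

/-! ### Reading bounds of all coefficients at once -/

/-- Check `loᵢ · S ≤ tlowerI Lᵢ` and `tupperI Lᵢ ≤ hiᵢ · S` for the listed bounds. [folklore] -/
def bndCheck (S : ℕ) (h : ℚ) : List IPoly → List (ℚ × ℚ) → Bool
  | _, [] => true
  | [], _ :: _ => false
  | P :: L, b :: bs => (decide (b.1 * S ≤ tlowerI S h P) && decide (tupperI S h P ≤ b.2 * S)) && bndCheck S h L bs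

/-- **Soundness of `bndCheck`.** [folklore] -/
theorem bnd_of_bndCheck (hS : 0 < S) (h0 : 0 ≤ h) :
    ∀ (L : List IPoly) (bs : List (ℚ × ℚ)) (f : ℕ → ℝ → ℝ), bndCheck S h L bs = true →
      (∀ i, i < bs.length → TMem S h (f i) (ent S L i)) →
      ∀ i (hi : i < bs.length) {ρ : ℝ}, |ρ| ≤ h →
        (((bs.getD i (0, 0)).1 : ℚ) : ℝ) ≤ f i ρ ∧ f i ρ ≤ (((bs.getD i (0, 0)).2 : ℚ) : ℝ)
  | _, [], _, _, _, i, hi, _, _ => by simp at hi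
  | [], _ :: _, _, hc, _, _, _, _, _ => by simp [bndCheck] at hc
  | P :: L, b :: bs, f, hc, hL, i, hi, ρ, hρ => by
      simp only [bndCheck, Bool.and_eq_true, decide_eq_true_eq] at hc
      obtain ⟨⟨h1, h2⟩, hrest⟩ := hc
      cases i with
      | zero =>
        have hP : TMem S h (f 0) P := by simpa [ent] using hL 0 (by simp)
        simpa using bounds_of_tmem hS h0 hP h1 h2 hρ
      | succ j =>
        have hj : j < bs.length := by simpa using hi
        have hL' : ∀ i, i < bs.length → TMem S h (f (i + 1)) (ent S L i) := fun i hi' => by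
          have := hL (i + 1) (by simpa using hi')
          simpa [ent] using this
        have := bnd_of_bndCheck hS h0 L bs (fun i => f (i + 1)) hrest hL' j hj hρ
        simpa using this

end OriginSeries

end BuckmasterCaolaboraGomezserrano2025

end Literature.Analysis.FluidPDE
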